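import Summits.Ventures.WeilGRH.TwistedGramAnyParity
import HarnessLib

/-!
# GRH arm (rh-explicit, venture WeilGRH): the χ-twisted Gram kernel of a COMPLEX character is REAL SYMMETRIC, with
  the same one-term Cauchy structure as ζ's — complex characters cost nothing extra

Cell `rh-explicit`, WEIL TRACK — GRH ARM (lit/typing seat weil-grh-5 gen11).  weil-grh-1's hermitian Gram kernel
`G = twistedGramCoeffC χ a` (`TwistedGramEvenComplex.lean`: `(gramCoeff − polarCoeff)(n,m) + (log q)δ
+ Σ_k Λ_k k^{-1/2}[(1 − χ(k))·P_k(m,n) + conj((1 − χ(k))·P_k(n,m))]`, `P_k = shiftCoeff a (log k)`) was interfaced for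
producers through a REALIFIED `2(2N+1)`-form (`weilPositivityOnChar_of_twistedGramCoeffC_realify_any`).  Observation
typed here: on Yoshida's exponential basis the shift pairing is SYMMETRIC, `P_t(m,n) = P_t(n,m)`
(`shiftCoeff_comm`: `(−1)^{n+m}(e^{iω_n t} − e^{iω_m t})/(2πi(m − n))` is invariant under `m ↔ n`), hence
`(1 − χ)P(m,n) + conj((1 − χ)P(n,m)) = 2 Re((1 − χ)P(m,n))` and

* `twistedGramCoeffC_im` — `Im G(n,m) = 0` for EVERY character χ (complex values included); `twistedGramCoeffC_comm` —
  `G(n,m) = G(m,n)`; `re_twistedGramCoeffC` — the real entries;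
* `re_twistedGramCoeffC_offDiag` — the ONE-TERM CAUCHY STRUCTURE on `ℤ`: for `n ≠ m`,
  `G(n,m) = (−1)^{n+m}(F^χ_m − F^χ_n)/(π(m − n))` with the complex-twisted mode function
  `F^χ_p = ½ Im ψ(¼ + iω_p/2) + Σ_k Λ_k k^{-1/2}(Re χ(k) sin(ω_p log k) + Im χ(k) cos(ω_p log k)) − T_p`
  (`T_p = archExpSumSin a p`); for real χ this is the mode function of `TwistedColumnKernel.lean`, whose sector formulas
  `(mF_m − iF_i)/(m² − i²)`, `(iF_m − mF_i)/(m² − i²)` are the `±` symmetrisations of `(F_m − F_i)/(m − i)`;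
* `re_sum_sum_conj_mul_twistedGramCoeffC` — the hermitian form is the SAME real quadratic form on real and imaginary
  parts: `Re Σ conj(c_n)c_m G(n,m) = Σ (Re c_n Re c_m + Im c_n Im c_m) G(n,m)`;
* `weilPositivityOnChar_of_twistedGramCoeffC_re_psd` — ONE real PSD statement per `N` (the `(2N+1) × (2N+1)` real matrix
  `Re G` on `modes N`) ⟹ `WeilPositivityOnChar χ a`, for ANY χ mod `q ≠ 1`, `a > 0` — half the size of the realified
  interface, and the input shape of weil-10's ℕ-indexed format-C soundness on ONE enumeration of `modes N`.

So a complex character differs from a real one only through the EVEN-in-`p` component `Im χ(k) cos(ω_p log k)` of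
`F^χ_p` (no reflection symmetry `p ↦ −p`, hence no even/odd sector split — the kernel is certified on `ℤ`-modes
directly), not through complex arithmetic.  No definitions; no named facts; RH/GRH-free; standard axioms.
-/

set_option autoImplicit false

noncomputable section

open Complex Finset
open scoped Real BigOperators ComplexConjugate ArithmeticFunction.vonMangoldt

namespace Summit.Ventures.WeilGRH

open Literature.NumberTheory.LFunctions
open Literature.NumberTheory.LFunctions.Yoshida1992 (modes chi freq gramCoeff polarCoeff primeCoeff incrCoeff archCoeff
  archExpSumSin)
open Summit.RiemannHypothesis.RiemannHypothesis.Theorems.WeilFormatC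

variable {q : ℕ} {a : ℝ}

/-! ## The shift pairing is symmetric; the kernel is real symmetric -/

section Real

/-- **`P_t(m,n) = P_t(n,m)`** on Yoshida's basis (the closed form is invariant under `m ↔ n`). -/
theorem shiftCoeff_comm (a t : ℝ) (m n : ℤ) : shiftCoeff a t m n = shiftCoeff a t n m := by
  unfold shiftCoeff
  by_cases h : m = n
  · subst h; rfl
  · rw [if_neg h, if_neg (Ne.symm h), show n + m = m + n from add_comm n m]
    have e : (((2 * π * (n - m) : ℝ) : ℂ)) = -((2 * π * (m - n) : ℝ) : ℂ) := by push_cast; ring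
    rw [e, neg_mul, div_neg, ← neg_div]
    congr 1
    ring

/-- **The twisted Gram kernel is real**: `Im G^χ(n,m) = 0` for every character (complex values included). -/
theorem twistedGramCoeffC_im (χ : DirichletCharacter ℂ q) (a : ℝ) (n m : ℤ) :
    (twistedGramCoeffC χ a n m).im = 0 := by
  unfold twistedGramCoeffC
  rw [Complex.add_im, Complex.ofReal_im, zero_add, Complex.im_sum]
  refine Finset.sum_eq_zero fun k _ ↦ ?_
  rw [shiftCoeff_comm a (Real.log k) n m, Complex.add_conj, ← Complex.ofReal_mul, Complex.ofReal_im]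

/-- `G^χ(n,m)` is the cast of its real part. -/
theorem twistedGramCoeffC_eq_ofReal_re (χ : DirichletCharacter ℂ q) (a : ℝ) (n m : ℤ) :
    twistedGramCoeffC χ a n m = (((twistedGramCoeffC χ a n m).re : ℝ) : ℂ) :=
  Complex.ext (by simp) (by rw [Complex.ofReal_im, twistedGramCoeffC_im])

/-- **Symmetry**: `G^χ(n,m) = G^χ(m,n)` (hermitian + real). -/
theorem twistedGramCoeffC_comm (χ : DirichletCharacter ℂ q) (a : ℝ) (n m : ℤ) :
    twistedGramCoeffC χ a n m = twistedGramCoeffC χ a m n := by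
  rw [twistedGramCoeffC_conj_symm χ a n m, twistedGramCoeffC_eq_ofReal_re χ a n m, Complex.conj_ofReal]

/-- **The real entries**: `Re G^χ(n,m) = (gramCoeff − polarCoeff)(n,m) + (log q)δ + Σ_k Λ_k k^{-1/2}·2Re((1 − χ(k))P_k(m,n))`. -/
theorem re_twistedGramCoeffC (χ : DirichletCharacter ℂ q) (a : ℝ) (n m : ℤ) :
    (twistedGramCoeffC χ a n m).re
      = gramCoeff a n m - polarCoeff a n m + (if n = m then Real.log q else 0)
        + ∑ k ∈ weilPrimeIndex a, (Λ k : ℝ) / Real.sqrt k *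
            (2 * ((1 - χ (k : ZMod q)) * shiftCoeff a (Real.log k) m n).re) := by
  unfold twistedGramCoeffC
  rw [Complex.add_re, Complex.ofReal_re, Complex.re_sum]
  congr 1
  refine Finset.sum_congr rfl fun k _ ↦ ?_
  rw [shiftCoeff_comm a (Real.log k) n m, Complex.add_conj, ← Complex.ofReal_mul, Complex.ofReal_re]

end Real

/-! ## The one-term Cauchy structure on `ℤ` -/

section Cauchy

/-- `Re (w / (c·i)) = Im w / c` for real `c`. -/
private theorem re_div_ofReal_mul_I (w : ℂ) (c : ℝ) : (w / ((c : ℂ) * I)).re = w.im / c := by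
  rw [div_eq_mul_inv, mul_inv, Complex.inv_I, ← Complex.ofReal_inv]
  simp only [Complex.mul_re, Complex.mul_im, Complex.ofReal_re, Complex.ofReal_im, Complex.neg_re, Complex.neg_im,
    Complex.I_re, Complex.I_im]
  ring

/-- `e^{iθ}` for real `θ`, written as in `shiftCoeff`: real and imaginary parts. -/
private theorem cexp_freq_mul_I_eq (θ t : ℝ) :
    cexp (((θ : ℝ) : ℂ) * t * I) = ((Real.cos (θ * t) : ℝ) : ℂ) + ((Real.sin (θ * t) : ℝ) : ℂ) * I := by
  rw [← Complex.ofReal_mul, Complex.exp_mul_I, ← Complex.ofReal_cos, ← Complex.ofReal_sin]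

/-- **The twisted shift entry, off the diagonal.**  For `m ≠ n` and any `w ∈ ℂ` (= `1 − χ(k)`):
`2 Re(w·P_t(m,n)) = (−1)^{n+m}[(Re w·sin ω_n t + Im w·cos ω_n t) − (Re w·sin ω_m t + Im w·cos ω_m t)]/(π(m − n))`
(`= (−1)^{n+m}(Im(w e^{iω_n t}) − Im(w e^{iω_m t}))/(π(m − n))`). -/
theorem two_mul_re_mul_shiftCoeff_of_ne (a t : ℝ) {m n : ℤ} (h : m ≠ n) (w : ℂ) :
    2 * (w * shiftCoeff a t m n).re
      = (-1 : ℝ) ^ (n + m) *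
          ((w.re * Real.sin (freq a n * t) + w.im * Real.cos (freq a n * t))
            - (w.re * Real.sin (freq a m * t) + w.im * Real.cos (freq a m * t))) / (π * (m - n)) := by
  unfold shiftCoeff
  rw [if_neg h, ← mul_div_assoc, re_div_ofReal_mul_I, cexp_freq_mul_I_eq, cexp_freq_mul_I_eq]
  have hs : ((-1 : ℂ) ^ (n + m)) = (((-1 : ℝ) ^ (n + m) : ℝ) : ℂ) := by push_cast; rfl
  rw [hs]
  unfold freq
  simp only [Complex.mul_im, Complex.mul_re, Complex.sub_re, Complex.sub_im, Complex.add_re, Complex.add_im,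
    Complex.ofReal_re, Complex.ofReal_im, Complex.I_re, Complex.I_im]
  have hπ : (π : ℝ) ≠ 0 := Real.pi_ne_zero
  have hmn : ((m : ℝ) - n) ≠ 0 := sub_ne_zero.mpr (by exact_mod_cast h)
  field_simp
  ring

/-- **One-term Cauchy structure of the twisted Gram kernel on `ℤ`.**  For `n ≠ m` and EVERY character χ:
`G^χ(n,m) = (−1)^{n+m}(F^χ_m − F^χ_n)/(π(m − n))`,
`F^χ_p = ½Im ψ(¼ + iω_p/2) + Σ_k Λ_k k^{-1/2}(Re χ(k) sin(ω_p log k) + Im χ(k) cos(ω_p log k)) − T_p`. -/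
theorem re_twistedGramCoeffC_offDiag (χ : DirichletCharacter ℂ q) (a : ℝ) {n m : ℤ} (h : n ≠ m) :
    (twistedGramCoeffC χ a n m).re
      = (-1 : ℝ) ^ (n + m) *
          (((Complex.digamma (1 / 4 + ((freq a m : ℝ) : ℂ) / 2 * I)).im / 2
              + (∑ k ∈ weilPrimeIndex a, (Λ k : ℝ) / Real.sqrt k *
                  ((χ (k : ZMod q)).re * Real.sin (freq a m * Real.log k)
                    + (χ (k : ZMod q)).im * Real.cos (freq a m * Real.log k)))
              - archExpSumSin a m)
            - ((Complex.digamma (1 / 4 + ((freq a n : ℝ) : ℂ) / 2 * I)).im / 2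
              + (∑ k ∈ weilPrimeIndex a, (Λ k : ℝ) / Real.sqrt k *
                  ((χ (k : ZMod q)).re * Real.sin (freq a n * Real.log k)
                    + (χ (k : ZMod q)).im * Real.cos (freq a n * Real.log k)))
              - archExpSumSin a n))
          / (π * (m - n)) := by
  rw [re_twistedGramCoeffC, if_neg h, add_zero]
  have hπ : (π : ℝ) ≠ 0 := Real.pi_ne_zero
  have hmn : ((m : ℝ) - n) ≠ 0 := sub_ne_zero.mpr (by exact_mod_cast (Ne.symm h))
  have hnm : ((n : ℝ) - m) ≠ 0 := sub_ne_zero.mpr (by exact_mod_cast h)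
  have hG : gramCoeff a n m - polarCoeff a n m
      + ∑ k ∈ weilPrimeIndex a, (Λ k : ℝ) / Real.sqrt k * (2 * ((1 - χ (k : ZMod q)) * shiftCoeff a (Real.log k) m n).re)
      = (primeCoeff a n m
          + ∑ k ∈ weilPrimeIndex a, (Λ k : ℝ) / Real.sqrt k *
              (2 * ((1 - χ (k : ZMod q)) * shiftCoeff a (Real.log k) m n).re))
        + archCoeff a n m := by
    unfold gramCoeff; ring
  -- the prime-power terms combine into the twisted prime mode function
  have hP : primeCoeff a n m
      + ∑ k ∈ weilPrimeIndex a, (Λ k : ℝ) / Real.sqrt k * (2 * ((1 - χ (k : ZMod q)) * shiftCoeff a (Real.log k) m n).re)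
      = ∑ k ∈ weilPrimeIndex a, ((-1 : ℝ) ^ (n + m) / (π * (m - n))) *
          ((Λ k : ℝ) / Real.sqrt k *
              ((χ (k : ZMod q)).re * Real.sin (freq a m * Real.log k) + (χ (k : ZMod q)).im * Real.cos (freq a m * Real.log k))
            - (Λ k : ℝ) / Real.sqrt k *
              ((χ (k : ZMod q)).re * Real.sin (freq a n * Real.log k) + (χ (k : ZMod q)).im * Real.cos (freq a n * Real.log k))) := by
    unfold primeCoeff
    rw [← Finset.sum_add_distrib]
    refine Finset.sum_congr rfl fun k _ ↦ ?_
    rw [if_neg h, sub_zero, two_mul_re_mul_shiftCoeff_of_ne a (Real.log k) (Ne.symm h)]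
    unfold incrCoeff
    rw [if_neg h]
    simp only [Complex.sub_re, Complex.sub_im, Complex.one_re, Complex.one_im]
    field_simp
    ring
  have hS : ∑ k ∈ weilPrimeIndex a, ((-1 : ℝ) ^ (n + m) / (π * (m - n))) *
          ((Λ k : ℝ) / Real.sqrt k *
              ((χ (k : ZMod q)).re * Real.sin (freq a m * Real.log k) + (χ (k : ZMod q)).im * Real.cos (freq a m * Real.log k))
            - (Λ k : ℝ) / Real.sqrt k *
              ((χ (k : ZMod q)).re * Real.sin (freq a n * Real.log k) + (χ (k : ZMod q)).im * Real.cos (freq a n * Real.log k)))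
      = ((-1 : ℝ) ^ (n + m) / (π * (m - n))) *
          ((∑ k ∈ weilPrimeIndex a, (Λ k : ℝ) / Real.sqrt k *
              ((χ (k : ZMod q)).re * Real.sin (freq a m * Real.log k) + (χ (k : ZMod q)).im * Real.cos (freq a m * Real.log k)))
            - ∑ k ∈ weilPrimeIndex a, (Λ k : ℝ) / Real.sqrt k *
              ((χ (k : ZMod q)).re * Real.sin (freq a n * Real.log k) + (χ (k : ZMod q)).im * Real.cos (freq a n * Real.log k))) := by
    rw [← Finset.mul_sum, Finset.sum_sub_distrib]
  have hA : archCoeff a n m = ((-1 : ℝ) ^ (n + m) / (π * (m - n))) *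
      (((Complex.digamma (1 / 4 + ((freq a m : ℝ) : ℂ) / 2 * I)).im / 2 - archExpSumSin a m)
        - ((Complex.digamma (1 / 4 + ((freq a n : ℝ) : ℂ) / 2 * I)).im / 2 - archExpSumSin a n)) := by
    unfold archCoeff
    rw [if_neg h]
    field_simp
    ring
  rw [hG, hP, hS, hA]
  field_simp
  ring

end Cauchy

/-! ## One real quadratic form certifies every character -/

section Door

/-- **The hermitian form of the twisted kernel is one real quadratic form on real and imaginary parts**:
`Re Σ_{n,m∈s} conj(c_n) c_m G^χ(n,m) = Σ_{n,m∈s} (Re c_n Re c_m + Im c_n Im c_m) Re G^χ(n,m)`. -/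
theorem re_sum_sum_conj_mul_twistedGramCoeffC (χ : DirichletCharacter ℂ q) (a : ℝ) (s : Finset ℤ) (c : ℤ → ℂ) :
    (∑ n ∈ s, ∑ m ∈ s, conj (c n) * c m * twistedGramCoeffC χ a n m).re
      = ∑ n ∈ s, ∑ m ∈ s, ((c n).re * (c m).re + (c n).im * (c m).im) * (twistedGramCoeffC χ a n m).re := by
  rw [Complex.re_sum]
  refine Finset.sum_congr rfl fun n _ ↦ ?_
  rw [Complex.re_sum]
  refine Finset.sum_congr rfl fun m _ ↦ ?_
  rw [Complex.mul_re, twistedGramCoeffC_im, mul_zero, sub_zero]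
  simp only [Complex.mul_re, Complex.conj_re, Complex.conj_im]
  ring

/-- **ONE real PSD statement per `N` certifies any character.**  For `q ≠ 1`, ANY χ mod `q`, `a > 0`: if the real
symmetric matrix `(Re G^χ(n,m))_{n,m ∈ modes N}` is positive semidefinite for every `N`, then `WeilPositivityOnChar χ a`.
(Half the size of `weilPositivityOnChar_of_twistedGramCoeffC_realify_any`.) -/
theorem weilPositivityOnChar_of_twistedGramCoeffC_re_psd (hq : q ≠ 1) (χ : DirichletCharacter ℂ q) (ha : 0 < a)
    (h : ∀ (N : ℕ) (x : ℤ → ℝ),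
      0 ≤ ∑ n ∈ modes N, ∑ m ∈ modes N, x n * x m * (twistedGramCoeffC χ a n m).re) :
    WeilPositivityOnChar χ a := by
  refine weilPositivityOnChar_of_twistedGramCoeffC_psd_any hq χ ha fun N c ↦ ?_
  have e : ∑ n ∈ modes N, ∑ m ∈ modes N, (conj (c n) * c m * twistedGramCoeffC χ a n m).re
      = (∑ n ∈ modes N, ∑ m ∈ modes N, conj (c n) * c m * twistedGramCoeffC χ a n m).re := by
    rw [Complex.re_sum]
    exact Finset.sum_congr rfl fun n _ ↦ (Complex.re_sum _ _).symm
  rw [e, re_sum_sum_conj_mul_twistedGramCoeffC]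
  have hsplit : ∑ n ∈ modes N, ∑ m ∈ modes N,
        ((c n).re * (c m).re + (c n).im * (c m).im) * (twistedGramCoeffC χ a n m).re
      = (∑ n ∈ modes N, ∑ m ∈ modes N, (c n).re * (c m).re * (twistedGramCoeffC χ a n m).re)
        + ∑ n ∈ modes N, ∑ m ∈ modes N, (c n).im * (c m).im * (twistedGramCoeffC χ a n m).re := by
    rw [← Finset.sum_add_distrib]
    refine Finset.sum_congr rfl fun n _ ↦ ?_
    rw [← Finset.sum_add_distrib]
    exact Finset.sum_congr rfl fun m _ ↦ by ring
  rw [hsplit]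
  exact add_nonneg (h N fun n ↦ (c n).re) (h N fun n ↦ (c n).im)

end Door

end Summit.Ventures.WeilGRH

end
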